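import Summits.Ventures.WeilGRH.TwistedWindowClosure
import Summits.Ventures.WeilGRH.TwistedWindowSectors
import Summits.RiemannHypothesis.RiemannHypothesis.Theorems.WeilFormatCEntrySesq
import Summits.RiemannHypothesis.RiemannHypothesis.Theorems.WeilFormatCEntryBasis
import HarnessLib

/-!
# GRH arm (rh-explicit, venture WeilGRH): the FLAT-WINDOW INEQUALITY — what a `χ`-rung EXCLUDES

Cell `rh-explicit`, WEIL TRACK (structure seat weil-3, gen7) for the GRH ARM.  Sequel of
`TwistedWindowClosure.lean` (`WeilPositivityOnChar χ a` ⟹ the twisted window form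
`𝓔^χ_a(u) − M^χ_a‖u‖₂²` is `≥ 0` on every smooth-inside window function `u`).  Here the window function
is the FLAT window `χ_0 = (2a)^{-1/2}𝟙_{[-a,a]}` (Yoshida's zero mode), whose twisted window form is
computed in closed form (`twistedWindowForm_chi_zero`):

  `𝓔^χ_a(χ_0) − M^χ_a = log q − F_χ(a)`,
  `F_χ(a) := 2 Σ_{log n < 2a} Λ(n) n^{-1/2} (1 − log n/(2a)) Re χ(n)`
            `+ [log 4π + γ + 2∫₀^∞ (e^{(1/2−κ)t} − 1) dt/(2 sinh t)] − (1/a) ∫₀^∞ e^{(1/2−κ)t}/(2 sinh t) · min(t, 2a) dt`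

(`κ = a_χ` the parity; twisted increments of the flat window: `D^ω_t(χ_0) = ‖1 − ω‖² + (Re ω)·min(t,2a)/a`).
Hence the **FLAT-WINDOW INEQUALITY** (`flatWindow_le_log_of_weilPositivityOnChar`): for every Dirichlet
character `χ` mod `q ≠ 1` and every `a > 0`,

  `WeilPositivityOnChar χ a  ⟹  F_χ(a) ≤ log q`,

a LINEAR constraint on the key `(Re χ(n))_{log n < 2a}` — one explicit supporting half-space of the set of
keys compatible with the rung (the outer companion of the key polytope of `KeyPolytope.lean`).  RH/GRH-free.
Two readings:

* **trivial key** (`χ(n) = 1` for every prime power `n < e^{2a}`,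
  `flatWindow_le_log_of_weilPositivityOnChar_of_trivial`): the rung forces
  `log q ≥ 2Σ_{n<e^{2a}} Λ(n)n^{-1/2}(1 − log n/(2a)) + K_κ − (1/a)∫ρ_κ·min(t,2a)` — the CONVERSE of the
  GRH arm's transfer theorem (`GeneralTransfer.lean`: `log q ≥ 2(sinh a + a) ⟹` rung for the trivial key):
  for characters that look principal below the window's horizon `e^{2a}` the rung is decided by the
  conductor alone, up to the gap between the flat and the optimal test function (at `a = 1`, even:
  `4.28 ≤ log q` necessary vs `4.35 ≤ log q` sufficient; GRH/STRUCTURE §16(f)'s certified optimum `4.306`);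
* **contrapositive** (`exists_vonMangoldt_ne_zero_chi_ne_one_of_weilPositivityOnChar`): if the rung at `a`
  holds and `log q` is below the trivial-key bound, some prime power `n < e^{2a}` has `χ(n) ≠ 1` — and with
  `GRH(χ) ⟹` every rung (`WeilPositivityChar.of_grh`) this is the positivity route to the least
  character non-residue (`…_of_grh`; Ankeny 1952 / Montgomery–Vaughan Thm 13.11 / Bach 1990 bound it by the
  DENSITY of zeros instead).

No definitions, no named facts, RH/GRH-free (the `_of_grh` corollaries take `GRH(χ)` as a hypothesis).

## References

* H. Yoshida, *On Hermitian forms attached to zeta functions*, Adv. Stud. Pure Math. 21 (1992) 281–325,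
  §3 (the basis `χ_n`), (5.15)/(5.16) (increment entries). [Yoshida1992]
* A. Weil, *Sur les "formules explicites" de la théorie des nombres premiers* (1952), (11) pp. 261–262.
  [Weil1952FormulesExplicites]
* E. Bombieri, *Remarks on Weil's quadratic functional in the theory of prime numbers I*, Rend. Mat. Acc.
  Lincei (9) 11 (2000) 183–233, Thm. 2 (the increment form of the explicit formula). [Bombieri2000Weil]
* H. L. Montgomery, R. C. Vaughan, *Multiplicative Number Theory I* (2007), §13.2, Theorem 13.11
  (GRH(χ) ⟹ n(χ) ≪ (log q)²; the density route). [MontgomeryVaughan2007]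
-/

set_option autoImplicit false

noncomputable section

open Complex Filter Set MeasureTheory
open scoped Real Topology ComplexConjugate ArithmeticFunction.vonMangoldt

namespace Summit.Ventures.WeilGRH

open Literature.NumberTheory.LFunctions
open Literature.NumberTheory.LFunctions.Yoshida1992 (chi chiCore contDiff_chiCore incrCoeff freq)
open Summit.RiemannHypothesis.RiemannHypothesis.Theorems.WeilFormatC

variable {q : ℕ} {a : ℝ}

/-! ## Twisted increments of real-valued window functions -/

/-- **Complex twists of a REAL window function are affine in the plain increment**: for `r : ℝ → ℝ`
bounded measurable vanishing off `[-a, a]` and `ω ∈ ℂ`,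
`D^ω_t(r) = ‖1 − ω‖² ‖r‖₂² + (Re ω) · D_t(r)`
(pointwise `|α − ωβ|² = (1 − Re ω)α² + (|ω|² − Re ω)β² + Re ω (α − β)²` for real `α, β`, and
`∫ r(x+t)² dx = ∫ r²`).  Companion of `weilTwistIncrement_ofReal` (real twist, complex function). -/
theorem weilTwistIncrement_ofReal_fun {r : ℝ → ℝ} {S : ℝ} (hm : Measurable r)
    (hz : ∀ x, x ∉ Icc (-a) a → r x = 0) (hb : ∀ x, |r x| ≤ S) (w₀ : ℂ) (t : ℝ) :
    weilTwistIncrement w₀ (fun x ↦ (r x : ℂ)) t =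
      ‖1 - w₀‖ ^ 2 * (∫ x, ‖(r x : ℂ)‖ ^ 2) + w₀.re * weilIncrement (fun x ↦ (r x : ℂ)) t := by
  have hmu : Measurable (fun x ↦ (r x : ℂ)) := Complex.measurable_ofReal.comp hm
  have hzu : ∀ x, x ∉ Icc (-a) a → (fun x ↦ (r x : ℂ)) x = 0 := fun x hx ↦ by
    simp only [hz x hx, Complex.ofReal_zero]
  have hbu : ∀ x, ‖(fun x ↦ (r x : ℂ)) x‖ ≤ S := fun x ↦ by
    simp only [Complex.norm_real, Real.norm_eq_abs]; exact hb x
  have hN : Integrable fun x ↦ ‖(r x : ℂ)‖ ^ 2 := integrable_norm_sq_window hmu hzu hbu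
  have hNt : Integrable fun x ↦ ‖(r (x + t) : ℂ)‖ ^ 2 := hN.comp_add_right t
  have hD : Integrable fun x ↦ ‖(r (x + t) : ℂ) - (r x : ℂ)‖ ^ 2 :=
    integrable_norm_sub_sq_window hmu hzu hbu t
  have e2 : ∀ y, ‖(r y : ℂ)‖ ^ 2 = r y ^ 2 := fun y ↦ by
    rw [Complex.norm_real, Real.norm_eq_abs, sq_abs]
  have e4 : ‖w₀‖ ^ 2 = w₀.re ^ 2 + w₀.im ^ 2 := by
    rw [Complex.sq_norm, Complex.normSq_apply]; ring
  have hpt : ∀ x, ‖(r (x + t) : ℂ) - w₀ * (r x : ℂ)‖ ^ 2 =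
      (1 - w₀.re) * ‖(r (x + t) : ℂ)‖ ^ 2 + (‖w₀‖ ^ 2 - w₀.re) * ‖(r x : ℂ)‖ ^ 2 +
        w₀.re * ‖(r (x + t) : ℂ) - (r x : ℂ)‖ ^ 2 := by
    intro x
    have e1 : ‖(r (x + t) : ℂ) - w₀ * (r x : ℂ)‖ ^ 2 =
        (r (x + t) - w₀.re * r x) ^ 2 + (w₀.im * r x) ^ 2 := by
      rw [Complex.sq_norm, Complex.normSq_apply]
      simp only [Complex.sub_re, Complex.sub_im, Complex.mul_re, Complex.mul_im, Complex.ofReal_re,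
        Complex.ofReal_im, mul_zero, sub_zero, zero_sub]
      ring
    have e3 : ‖(r (x + t) : ℂ) - (r x : ℂ)‖ ^ 2 = (r (x + t) - r x) ^ 2 := by
      rw [← Complex.ofReal_sub, Complex.norm_real, Real.norm_eq_abs, sq_abs]
    rw [e1, e2, e2, e3, e4]
    ring
  have h1 : Integrable fun x ↦ (1 - w₀.re) * ‖(r (x + t) : ℂ)‖ ^ 2 := hNt.const_mul _
  have h2 : Integrable fun x ↦ (‖w₀‖ ^ 2 - w₀.re) * ‖(r x : ℂ)‖ ^ 2 := hN.const_mul _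
  have h12 : Integrable fun x ↦ (1 - w₀.re) * ‖(r (x + t) : ℂ)‖ ^ 2 +
      (‖w₀‖ ^ 2 - w₀.re) * ‖(r x : ℂ)‖ ^ 2 := h1.add h2
  have h3 : Integrable fun x ↦ w₀.re * ‖(r (x + t) : ℂ) - (r x : ℂ)‖ ^ 2 := hD.const_mul _
  have hw : ‖1 - w₀‖ ^ 2 = 1 - 2 * w₀.re + ‖w₀‖ ^ 2 := by
    rw [Complex.sq_norm, Complex.sq_norm, Complex.normSq_apply, Complex.normSq_apply]
    simp only [Complex.sub_re, Complex.one_re, Complex.sub_im, Complex.one_im, zero_sub]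
    ring
  have hshift : ∫ x, ‖(r (x + t) : ℂ)‖ ^ 2 = ∫ x, ‖(r x : ℂ)‖ ^ 2 :=
    integral_add_right_eq_self (fun x ↦ ‖(r x : ℂ)‖ ^ 2) t
  unfold weilTwistIncrement weilIncrement
  simp only [hpt]
  rw [integral_add h12 h3, integral_add h1 h2, integral_const_mul, integral_const_mul,
    integral_const_mul, hshift, hw]
  ring

/-! ## Yoshida's zero mode `χ_0 = (2a)^{-1/2}𝟙_{[-a,a]}`: norm, increments, twisted increments -/

/-- The zero mode is the real flat window: `χ_0(x) = (2a)^{-1/2}𝟙_{[-a,a]}(x)` (as a real function cast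
to `ℂ`). -/
theorem chi_zero_eq_ofReal_indicator (a : ℝ) :
    chi a 0 = fun x ↦ (((Icc (-a) a).indicator (fun _ ↦ 1 / Real.sqrt (2 * a)) x : ℝ) : ℂ) := by
  funext x
  by_cases hx : x ∈ Icc (-a) a
  · rw [chi_apply_of_mem 0 hx, indicator_of_mem hx]
    simp
  · rw [chi_apply_of_not_mem 0 hx, indicator_of_notMem hx, Complex.ofReal_zero]

/-- `‖χ_0‖₂² = 1` (`a > 0`). -/
theorem integral_norm_sq_chi_zero (ha : 0 < a) : ∫ x, ‖chi a 0 x‖ ^ 2 = 1 := by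
  have h := integral_norm_sq_sum_smul_chi ha {0} (fun _ ↦ (1 : ℂ))
  simp only [Finset.sum_singleton, one_smul, norm_one, one_pow] at h
  exact h

/-- **Increments of the flat window**: `D_t(χ_0) = min(t, 2a)/a` for `t ≥ 0` (`a > 0`): the translate
differs from `χ_0` on two intervals of length `min(t, 2a)` where one of them is `(2a)^{-1/2}`
(Yoshida's increment entry `incrCoeff a t 0 0 = 2 − 2(1 − t/2a)` on `[0, 2a]`, `2` beyond). -/
theorem weilIncrement_chi_zero (ha : 0 < a) {t : ℝ} (ht : 0 ≤ t) :
    weilIncrement (chi a 0) t = min t (2 * a) / a := by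
  have hself := weilIncrementSesq_self (chi a 0) t
  rcases le_or_gt t (2 * a) with h2 | h2
  · rw [weilIncrementSesq_chi ha 0 0 ht h2] at hself
    have h := Complex.ofReal_injective hself
    rw [← h, min_eq_left h2, incrCoeff]
    simp only [if_true, freq, Int.cast_zero, mul_zero, zero_div, zero_mul, Real.cos_zero, mul_one]
    field_simp
    ring
  · rw [weilIncrementSesq_chi_of_le ha 0 0 h2.le] at hself
    have h := Complex.ofReal_injective hself
    rw [← h, min_eq_right h2.le]
    simp only [if_true]
    field_simp

/-- **Twisted increments of the flat window**: `D^ω_t(χ_0) = ‖1 − ω‖² + (Re ω)·min(t, 2a)/a` for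
`t ≥ 0`, `a > 0`, `ω ∈ ℂ`. -/
theorem weilTwistIncrement_chi_zero (ha : 0 < a) (w₀ : ℂ) {t : ℝ} (ht : 0 ≤ t) :
    weilTwistIncrement w₀ (chi a 0) t = ‖1 - w₀‖ ^ 2 + w₀.re * (min t (2 * a) / a) := by
  have hr := chi_zero_eq_ofReal_indicator a
  have hm : Measurable fun x ↦ (Icc (-a) a).indicator (fun _ ↦ 1 / Real.sqrt (2 * a)) x :=
    measurable_const.indicator measurableSet_Icc
  have hz : ∀ x, x ∉ Icc (-a) a → (Icc (-a) a).indicator (fun _ ↦ 1 / Real.sqrt (2 * a)) x = 0 :=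
    fun x hx ↦ indicator_of_notMem hx _
  have hb : ∀ x, |(Icc (-a) a).indicator (fun _ ↦ 1 / Real.sqrt (2 * a)) x| ≤ 1 / Real.sqrt (2 * a) := by
    intro x
    by_cases hx : x ∈ Icc (-a) a
    · rw [indicator_of_mem hx, abs_of_nonneg (by positivity)]
    · rw [indicator_of_notMem hx, abs_zero]; positivity
  have hN : ∫ x, ‖(((Icc (-a) a).indicator (fun _ ↦ 1 / Real.sqrt (2 * a)) x : ℝ) : ℂ)‖ ^ 2 = 1 := by
    have h1 := integral_norm_sq_chi_zero ha
    rw [hr] at h1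
    simpa only using h1
  have h := weilTwistIncrement_ofReal_fun hm hz hb w₀ t
  rw [← hr, hN] at h
  rw [h, weilIncrement_chi_zero ha ht, mul_one]

/-! ## The twisted window form of the flat window, in closed form -/

/-- Per prime power: `‖1 − conj z‖² + Re(conj z)·L/a − (1 + ‖z‖²) = −2 (1 − L/(2a)) Re z`. -/
private theorem key_term_identity (z : ℂ) (L : ℝ) (ha : a ≠ 0) :
    ‖1 - conj z‖ ^ 2 + (conj z).re * (L / a) - (1 + ‖z‖ ^ 2) = -(2 * ((1 - L / (2 * a)) * z.re)) := by
  rw [Complex.sq_norm, Complex.sq_norm, Complex.normSq_apply, Complex.normSq_apply]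
  simp only [Complex.sub_re, Complex.one_re, Complex.conj_re, Complex.sub_im, Complex.one_im,
    Complex.conj_im, sub_neg_eq_add]
  field_simp
  ring

/-- **The twisted energy of the flat window** (`a > 0`):
`𝓔^χ_a(χ_0) = Σ_{log n<2a} Λ(n)n^{-1/2}(‖1 − χ(n)‖²·… ) + (1/a)∫₀^∞ ρ_κ(t) min(t,2a) dt`, precisely
`= Σ_{log n<2a} Λ(n)n^{-1/2}(‖1 − conj χ(n)‖² + Re(conj χ(n)) (log n)/a) + (1/a)∫₀^∞ ρ_κ(t)·min(t, 2a) dt`. -/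
theorem weilDirichletEnergyChar_chi_zero (χ : DirichletCharacter ℂ q) (ha : 0 < a) :
    weilDirichletEnergyChar χ a (chi a 0) =
      (∑ n ∈ weilPrimeIndex a, (Λ n : ℝ) / Real.sqrt n *
          (‖1 - conj (χ (n : ZMod q))‖ ^ 2 + (conj (χ (n : ZMod q))).re * (Real.log n / a))) +
        1 / a * ∫ t in Ioi (0 : ℝ), weilArchDensityPar (charParity χ) t * min t (2 * a) := by
  unfold weilDirichletEnergyChar
  congr 1
  · refine Finset.sum_congr rfl fun n hn ↦ ?_
    have hlog : Real.log n < 2 * a := mem_weilPrimeIndex.1 hn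
    rw [weilTwistIncrement_chi_zero ha _ (Real.log_natCast_nonneg n), min_eq_left hlog.le]
  · rw [← integral_const_mul]
    refine setIntegral_congr_fun measurableSet_Ioi fun t (ht : 0 < t) ↦ ?_
    rw [weilIncrement_chi_zero ha ht.le]
    field_simp

/-- **THE TWISTED WINDOW FORM OF THE FLAT WINDOW, IN CLOSED FORM** (`a > 0`, any `χ` mod `q`, parity
`κ = a_χ`, `ρ_κ(t) = e^{(1/2−κ)t}/(2 sinh t)`):
`𝓔^χ_a(χ_0) − M^χ_a‖χ_0‖₂² = log q − [2Σ_{log n<2a} Λ(n)n^{-1/2}(1 − log n/(2a)) Re χ(n)`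
  `+ (log 4π + γ + 2∫₀^∞ (e^{(1/2−κ)t} − 1)dt/(2 sinh t)) − (1/a)∫₀^∞ ρ_κ(t) min(t, 2a) dt]`. -/
theorem twistedWindowForm_chi_zero (χ : DirichletCharacter ℂ q) (ha : 0 < a) :
    weilDirichletEnergyChar χ a (chi a 0) - weilMarkovConstantChar χ a * ∫ x : ℝ, ‖chi a 0 x‖ ^ 2 =
      Real.log q -
        (2 * (∑ n ∈ weilPrimeIndex a,
              (Λ n : ℝ) / Real.sqrt n * ((1 - Real.log n / (2 * a)) * (χ (n : ZMod q)).re)) +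
          (Real.log (4 * π) + Real.eulerMascheroniConstant +
            2 * ∫ t in Ioi (0 : ℝ), weilKillingDensityPar (charParity χ) t) -
          1 / a * ∫ t in Ioi (0 : ℝ), weilArchDensityPar (charParity χ) t * min t (2 * a)) := by
  rw [weilDirichletEnergyChar_chi_zero χ ha, integral_norm_sq_chi_zero ha, mul_one]
  unfold weilMarkovConstantChar
  have hsum : (∑ n ∈ weilPrimeIndex a, (Λ n : ℝ) / Real.sqrt n *
        (‖1 - conj (χ (n : ZMod q))‖ ^ 2 + (conj (χ (n : ZMod q))).re * (Real.log n / a))) -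
      ∑ n ∈ weilPrimeIndex a, (Λ n : ℝ) / Real.sqrt n * (1 + ‖χ (n : ZMod q)‖ ^ 2) =
      -(2 * ∑ n ∈ weilPrimeIndex a,
          (Λ n : ℝ) / Real.sqrt n * ((1 - Real.log n / (2 * a)) * (χ (n : ZMod q)).re)) := by
    rw [← Finset.sum_sub_distrib, Finset.mul_sum, ← Finset.sum_neg_distrib]
    refine Finset.sum_congr rfl fun n _ ↦ ?_
    rw [← mul_sub, key_term_identity _ _ ha.ne']
    ring
  linarith [hsum]

/-! ## The two-sided conductor law: the key-free ceiling and the flat-window floor -/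

/-- **The key-free CEILING** (every character, every window): if `M^χ_a ≤ 0`, i.e.
`log q ≥ Σ_{log n<2a} Λ(n)n^{-1/2}(1 + |χ(n)|²) + log 4π + γ + 2∫₀^∞(e^{(1/2−κ)t} − 1)dt/(2 sinh t)`, then
`WeilPositivityOnChar χ a` — the twisted energy is `≥ 0` and the killing constant has the sign of
`−log q + …` (`neg_weilMarkovConstantChar_mul_le_re_weilQuadraticChar`).  RH/GRH-free, no `ζ` rung needed
(unlike the sharper transfer ceiling `2(sinh a + a) + … ≤ log q` of `GeneralTransfer.lean`). -/
theorem weilPositivityOnChar_of_weilMarkovConstantChar_nonpos (hq : q ≠ 1) (χ : DirichletCharacter ℂ q)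
    (hM : weilMarkovConstantChar χ a ≤ 0) : WeilPositivityOnChar χ a := by
  intro g hg hsupp
  have h := neg_weilMarkovConstantChar_mul_le_re_weilQuadraticChar hq χ hg hsupp
  have hN : 0 ≤ ∫ x : ℝ, ‖g x‖ ^ 2 := integral_nonneg fun x ↦ by positivity
  nlinarith

/-- **THE FLAT-WINDOW INEQUALITY — what a `χ`-rung EXCLUDES.**  For every Dirichlet character `χ`
mod `q ≠ 1` (any parity `κ = a_χ`, any values, primitivity not needed) and every window `a > 0`:
if `WeilPositivityOnChar χ a`, then

  `2 Σ_{log n < 2a} Λ(n) n^{-1/2} (1 − log n/(2a)) · Re χ(n)`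
    `+ [log 4π + γ + 2∫₀^∞ (e^{(1/2−κ)t} − 1) dt/(2 sinh t)] − (1/a) ∫₀^∞ e^{(1/2−κ)t}/(2 sinh t) · min(t, 2a) dt ≤ log q`.

The rung is a family of inequalities indexed by test functions; this is the one carried by the flat
window `χ_0 = (2a)^{-1/2}𝟙_{[-a,a]}` (`twistedWindowForm_chi_zero` + `TwistedWindowClosure.lean`).  It is
LINEAR in the key `(Re χ(n))_{log n<2a}`: an explicit supporting half-space of the set of keys compatible
with the rung at `(a, q)`.  RH/GRH-free. -/
theorem flatWindow_le_log_of_weilPositivityOnChar (hq : q ≠ 1) (χ : DirichletCharacter ℂ q)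
    (ha : 0 < a) (hW : WeilPositivityOnChar χ a) :
    2 * (∑ n ∈ weilPrimeIndex a,
          (Λ n : ℝ) / Real.sqrt n * ((1 - Real.log n / (2 * a)) * (χ (n : ZMod q)).re)) +
        (Real.log (4 * π) + Real.eulerMascheroniConstant +
          2 * ∫ t in Ioi (0 : ℝ), weilKillingDensityPar (charParity χ) t) -
        1 / a * ∫ t in Ioi (0 : ℝ), weilArchDensityPar (charParity χ) t * min t (2 * a) ≤
      Real.log q := by
  have h := twistedWindowForm_nonneg_of_weilPositivityOnChar_of_mem_K hq χ ha hW
    (Yoshida1992.chi_mem_K a 0)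
  rw [twistedWindowForm_chi_zero χ ha] at h
  linarith

/-- **The trivial key: the CONVERSE of the transfer theorem.**  If `WeilPositivityOnChar χ a` (`q ≠ 1`,
`a > 0`) and `χ(n) = 1` for every prime power `n < e^{2a}` (the character looks principal below the
window's horizon), then

  `2 Σ_{log n < 2a} Λ(n) n^{-1/2} (1 − log n/(2a)) + K_κ − (1/a)∫₀^∞ ρ_κ(t) min(t, 2a) dt ≤ log q`

(`K_κ = log 4π + γ + 2∫₀^∞ (e^{(1/2−κ)t} − 1)dt/(2 sinh t)`, `ρ_κ(t) = e^{(1/2−κ)t}/(2 sinh t)`): the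
conductor must be large — compare `GeneralTransfer.weilPositivityOnChar_transfer_window`
(`2(sinh a + a) ≤ log q` and the `ζ` rung at `a` ⟹ the `χ`-rung, for the trivial key). -/
theorem flatWindow_le_log_of_weilPositivityOnChar_of_trivial (hq : q ≠ 1) (χ : DirichletCharacter ℂ q)
    (ha : 0 < a) (hW : WeilPositivityOnChar χ a)
    (hkey : ∀ n ∈ weilPrimeIndex a, Λ n ≠ 0 → χ (n : ZMod q) = 1) :
    2 * (∑ n ∈ weilPrimeIndex a, (Λ n : ℝ) / Real.sqrt n * (1 - Real.log n / (2 * a))) +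
        (Real.log (4 * π) + Real.eulerMascheroniConstant +
          2 * ∫ t in Ioi (0 : ℝ), weilKillingDensityPar (charParity χ) t) -
        1 / a * ∫ t in Ioi (0 : ℝ), weilArchDensityPar (charParity χ) t * min t (2 * a) ≤
      Real.log q := by
  have h := flatWindow_le_log_of_weilPositivityOnChar hq χ ha hW
  have hs : ∑ n ∈ weilPrimeIndex a,
        (Λ n : ℝ) / Real.sqrt n * ((1 - Real.log n / (2 * a)) * (χ (n : ZMod q)).re) =
      ∑ n ∈ weilPrimeIndex a, (Λ n : ℝ) / Real.sqrt n * (1 - Real.log n / (2 * a)) := by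
    refine Finset.sum_congr rfl fun n hn ↦ ?_
    by_cases hΛ : Λ n = 0
    · simp [hΛ]
    · rw [hkey n hn hΛ, Complex.one_re, mul_one]
  linarith [hs]

/-- **Contrapositive: the rung NAMES a non-trivial prime power below its horizon.**  If
`WeilPositivityOnChar χ a` (`q ≠ 1`, `a > 0`) and `log q` is below the trivial-key bound of
`flatWindow_le_log_of_weilPositivityOnChar_of_trivial`, then `χ(n) ≠ 1` for some prime power `n` with
`log n < 2a` (a character non-residue — or a prime power dividing `q` — below `e^{2a}`). -/
theorem exists_vonMangoldt_ne_zero_chi_ne_one_of_weilPositivityOnChar (hq : q ≠ 1)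
    (χ : DirichletCharacter ℂ q) (ha : 0 < a) (hW : WeilPositivityOnChar χ a)
    (hlt : Real.log q <
      2 * (∑ n ∈ weilPrimeIndex a, (Λ n : ℝ) / Real.sqrt n * (1 - Real.log n / (2 * a))) +
        (Real.log (4 * π) + Real.eulerMascheroniConstant +
          2 * ∫ t in Ioi (0 : ℝ), weilKillingDensityPar (charParity χ) t) -
        1 / a * ∫ t in Ioi (0 : ℝ), weilArchDensityPar (charParity χ) t * min t (2 * a)) :
    ∃ n ∈ weilPrimeIndex a, Λ n ≠ 0 ∧ χ (n : ZMod q) ≠ 1 := by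
  by_contra h
  push Not at h
  exact (not_le.2 hlt) (flatWindow_le_log_of_weilPositivityOnChar_of_trivial hq χ ha hW h)

/-! ## Under `GRH(χ)`: every rung holds, so every window gives a flat-window inequality -/

/-- **`GRH(χ)` ⟹ the flat-window inequality at EVERY window `a > 0`** (`χ` primitive mod `q ≠ 1`;
`GRH(χ)` ⟹ `WeilPositivityOnChar χ a` by `WeilPositivityChar.of_grh`, the proved explicit formula).  So
`GRH(χ)` forces cancellation in every smoothed twisted prime sum below `e^{2a}`:
`Σ_{log n<2a}Λ(n)n^{-1/2}(1 − log n/(2a)) Re χ(n) ≤ (log q − K_κ + (1/a)∫ρ_κ min(t,2a))/2`. -/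
theorem flatWindow_le_log_of_grh [NeZero q] (hq : q ≠ 1) {χ : DirichletCharacter ℂ q}
    (hprim : χ.IsPrimitive) (hGRH : χ.RiemannHypothesis) (ha : 0 < a) :
    2 * (∑ n ∈ weilPrimeIndex a,
          (Λ n : ℝ) / Real.sqrt n * ((1 - Real.log n / (2 * a)) * (χ (n : ZMod q)).re)) +
        (Real.log (4 * π) + Real.eulerMascheroniConstant +
          2 * ∫ t in Ioi (0 : ℝ), weilKillingDensityPar (charParity χ) t) -
        1 / a * ∫ t in Ioi (0 : ℝ), weilArchDensityPar (charParity χ) t * min t (2 * a) ≤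
      Real.log q :=
  flatWindow_le_log_of_weilPositivityOnChar hq χ ha ((WeilPositivityChar.of_grh hq hprim hGRH).on a)

/-- **`GRH(χ)` ⟹ a non-trivial prime power below every horizon the conductor cannot pay for** (the
POSITIVITY route to the least character non-residue; Ankeny 1952 / Montgomery–Vaughan Thm 13.11 /
Bach 1990 reach `n(χ) ≪ (log q)²` by the DENSITY of zeros instead): for `χ` primitive mod `q ≠ 1` with
`GRH(χ)` and any `a > 0` with
`log q < 2Σ_{log n<2a}Λ(n)n^{-1/2}(1 − log n/(2a)) + K_κ − (1/a)∫ρ_κ min(t,2a)`, some prime power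
`n < e^{2a}` has `χ(n) ≠ 1`. -/
theorem exists_vonMangoldt_ne_zero_chi_ne_one_of_grh [NeZero q] (hq : q ≠ 1)
    {χ : DirichletCharacter ℂ q} (hprim : χ.IsPrimitive) (hGRH : χ.RiemannHypothesis) (ha : 0 < a)
    (hlt : Real.log q <
      2 * (∑ n ∈ weilPrimeIndex a, (Λ n : ℝ) / Real.sqrt n * (1 - Real.log n / (2 * a))) +
        (Real.log (4 * π) + Real.eulerMascheroniConstant +
          2 * ∫ t in Ioi (0 : ℝ), weilKillingDensityPar (charParity χ) t) -
        1 / a * ∫ t in Ioi (0 : ℝ), weilArchDensityPar (charParity χ) t * min t (2 * a)) :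
    ∃ n ∈ weilPrimeIndex a, Λ n ≠ 0 ∧ χ (n : ZMod q) ≠ 1 :=
  exists_vonMangoldt_ne_zero_chi_ne_one_of_weilPositivityOnChar hq χ ha
    ((WeilPositivityChar.of_grh hq hprim hGRH).on a) hlt

end Summit.Ventures.WeilGRH

end
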